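import Literature.NumberTheory.Automorphic.QuadraticAdeleBaseChange
import Mathlib.Data.Matrix.Composition
import Mathlib.LinearAlgebra.Matrix.Kronecker
import Mathlib.Topology.Instances.Matrix
import HarnessLib

/-!
# Quadratic restriction of scalars: `GLₙ(E ⊗_F F_v) → GL₂ₙ(F_v)` and `GLₙ(𝔸_E) → GL₂ₙ(𝔸_F)`
(the regular representation of `S = R ⊕ R δ`, `δ² = d`, on matrices — Lang, *Algebra*, Ch. VI §5 (the matrix of
multiplication by an element), Ch. XIII §1; applied to `E ⊗_F F_v = F_v ⊕ F_v δ` and `𝔸_E = 𝔸_F ⊕ 𝔸_F δ`,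
Cassels–Fröhlich Ch. II §§9–10, §14)

Topic `NumberTheory/Automorphic`; namespace `Literature.NumberTheory.Automorphic.UnitaryGroup` (fourth part of
`QuadraticLocalBaseChange`, `QuadraticArchimedeanBaseChange`, `QuadraticAdeleBaseChange`). Definitions and proved lemmas
only: **no named facts, 0 proof holes**.

**Setting.** §1 is pure algebra: commutative rings `R, S`, a ring map `φ : R → S`, an additive isomorphism
`Ψ : R × R ≃ S` and `δ ∈ S`, `d ∈ R` with `Ψ (a, b) = φ a + φ b · δ` and `δ² = φ d` (`IsQuadraticCoordinates φ Ψ δ d`: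
"`S = φ(R) ⊕ φ(R) δ` is free of rank `2` over `R` with basis `(1, δ)`"). §§3–4 instantiate it with the four
quadratic base-change isomorphisms of this series, for a quadratic extension `E/F` of number fields, `σ ∈ Aut(E/F)`,
`σ δ = -δ ≠ 0` and `δ² = d ∈ F` (`exists_mul_self_eq_algebraMap`, §2).

* §1 coordinates `re, im : S → R` (`x = φ (re x) + φ (im x) · δ`), the product rule
  `re (x y) = re x · re y + d · im x · im y`, `im (x y) = re x · im y + im x · re y`, the **regular representation**
  `mulMatrix : S →+* M₂(R)`, `x ↦ (re x, d · im x; im x, re x)` (injective; `φ a ↦ a · 1₂`), and the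
  **restriction of scalars for matrices** `restrictScalars : Mₙ(S) →+* M_{n × 2}(R)` (block matrix of the `mulMatrix (g i j)`;
  `= Matrix.comp ∘ mulMatrix.mapMatrix`), characterised by **`coords (g x) = restrictScalars g · coords x`**
  (`coords_mulVec`: it is the matrix of `x ↦ g x` on `Sⁿ = R^{n × 2}`), with `restrictScalars (a.map φ) = a ⊗ 1₂`
  (`restrictScalars_map`), injective, continuous when `Ψ⁻¹` is; on units
  **`restrictScalarsGL : GLₙ(S) →* GL_{n × 2}(R)`** (injective, continuous).
* §2 `δ² ∈ F` for `σ δ = -δ ≠ 0` in a quadratic extension.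
* §3 the local carriers: `localRestrictScalarsGL : GLₙ(∏_{w ∣ v} E_w) →* GL_{n × 2}(F_v)` for finite `v`
  (`Ψ_v = quadraticLocalEquiv`) and `infLocalRestrictScalarsGL` for `v ∣ ∞` (`Ψ_v = quadraticInfLocalEquiv`), injective
  and continuous, `= a ⊗ 1₂` on `GLₙ(F_v)`.
* §4 the adelic carriers: `finiteAdeleRestrictScalarsGL : GLₙ(𝔸_E^∞) →* GL_{n × 2}(𝔸_F^∞)` and
  **`adeleRestrictScalarsGL : GLₙ(𝔸_E) →* GL_{n × 2}(𝔸_F)`** (`Ψ = quadraticFiniteAdeleContinuousEquiv`,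
  `quadraticAdeleEquiv`; `φ = (· ⊗ 1)` the tree's base change), injective and continuous, `= a ⊗ 1₂` on `GLₙ(𝔸_F)`;
  `exists_quadraticCoordinates_adele` (parameter-free form).
* §5 the unitary-group carriers (restriction to the tree's `UnitaryGroup.«local»`, `localPi`, `adelic`):
  **`localUnitaryCarrier : U(J)(F_v) →* GL_{N × 2}(F_v)`**, `localPiUnitaryCarrier : localPi →* GL_{N × 2}(F_v)` and
  **`adelicUnitaryCarrier : U(J)(𝔸_F) →* GL_{N × 2}(𝔸_F)`**, injective and continuous (for `N = 3`:
  `U(V)(F_v) → GL₆(F_v)`, `U(V)(𝔸_F) → GL₆(𝔸_F)`).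

These are the carrier maps `GLₙ(E ⊗_F F_v) → GL₂ₙ(F_v)`, `GLₙ(E ⊗_F 𝔸_F) → GL₂ₙ(𝔸_F)` through which a unitary group
`U(V) ≤ GL₃(E ⊗_F ·)` of a `3`-dimensional hermitian space over `E` acts `F`-linearly on `Res_{E/F} V ≅ F⁶`
(index type `n × Fin 2`; reindex with `Matrix.reindex` / `finProdFinEquiv` as needed).

## Mathlib / tree

Mathlib: `Matrix.comp` / `Matrix.compRingEquiv` (`Data/Matrix/Composition`), `RingHom.mapMatrix`, `Matrix.kroneckerMap`,
`Matrix.GeneralLinearGroup` = units of `Matrix n n R` with `Units.map` / `Units.continuous_map`, `continuous_matrix`;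
Mathlib's `Algebra.leftMulMatrix` / `Basis.smulTower` give the same matrices for an `Algebra R S` with a basis, but
the adele rings of this series carry no `Algebra (𝔸_F) (𝔸_E)` instance (by design: `AdeleBaseChange`), whence the
basis-free formulation through `(φ, Ψ, δ, d)`. Tree: `QuadraticLocalBaseChange` (`toLocalRing`, `quadraticLocalEquiv`,
`exists_eq_add_mul_of_isQuadraticExtension`, `exists_algEquiv_apply_eq_neg`), `QuadraticArchimedeanBaseChange`
(`quadraticInfLocalEquiv`, `toInfPlace_coe`), `QuadraticAdeleBaseChange` (`quadraticFiniteAdeleContinuousEquiv`,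
`quadraticAdeleEquiv`), `AdeleBaseChange` (`FiniteAdeleRing.baseChange`, `AdeleRing.baseChange`, `baseChange_algebraMap`),
`UnitaryGroupAutomorphicRep` / `UnitaryGroupLocalFactors` (`UnitaryGroup.«local»`, `adelic`, `localPi`, `localPiEquiv`).

## Provenance

Written under the LEAN-IN-TREE rule (2026-08-18) for the pub-hodgecm formalisation cell (model-construction sub-cell,
base-change junction: the `GL_N` carrier maps induced by `E ⊗_F F_v = ∏_{w ∣ v} E_w` and `E ⊗_F 𝔸_F = 𝔸_E`). Nothing in
this file is a claim of the manuscripts adjudicated by that cell.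

## References

* S. Lang, *Algebra*, Graduate Texts in Mathematics 211 (2002), Ch. VI §5, Ch. XIII §1 [Lang2002].
* J. W. S. Cassels, A. Fröhlich (eds.), *Algebraic Number Theory* (1967), Ch. II §§9–10, §14 [CasselsFrohlichANT1967].
-/

noncomputable section

open NumberField IsDedekindDomain Topology Filter Matrix

namespace Literature.NumberTheory.Automorphic

namespace UnitaryGroup

/-! ## 1. Quadratic coordinates: `S = φ(R) ⊕ φ(R) δ` with `δ² = φ(d)`, and restriction of scalars for matrices -/

section QuadraticCoordinates

variable {R S : Type*} [CommRing R] [CommRing S]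

/-- **Quadratic coordinates.** `Ψ : R × R ≃ S` is `(a, b) ↦ φ a + φ b · δ` for a ring map `φ : R → S` and an
element `δ ∈ S` with `δ² = φ d`: then `S` is a free `R`-module (through `φ`) with basis `(1, δ)`. The three
instances below are `E ⊗_F F_v = F_v ⊕ F_v δ` (finite and infinite `v`) and `𝔸_E = 𝔸_F ⊕ 𝔸_F δ`. [folklore] -/
structure IsQuadraticCoordinates (φ : R →+* S) (Ψ : (R × R) ≃+ S) (δ : S) (d : R) : Prop where
  apply : ∀ a b : R, Ψ (a, b) = φ a + φ b * δ
  mul_self : δ * δ = φ d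

namespace QuadraticCoordinates

variable (Ψ : (R × R) ≃+ S)

/-- The first coordinate `re : S → R` of `Ψ⁻¹` (`x = φ (re x) + φ (im x) · δ`). [folklore] -/
def re : S →+ R := (AddMonoidHom.fst R R).comp Ψ.symm.toAddMonoidHom

/-- The second coordinate `im : S → R` of `Ψ⁻¹` (`x = φ (re x) + φ (im x) · δ`). [folklore] -/
def im : S →+ R := (AddMonoidHom.snd R R).comp Ψ.symm.toAddMonoidHom

/-- `re x = (Ψ⁻¹ x).1` (definitional). [folklore] -/
theorem re_def (x : S) : re Ψ x = (Ψ.symm x).1 := rfl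

/-- `im x = (Ψ⁻¹ x).2` (definitional). [folklore] -/
theorem im_def (x : S) : im Ψ x = (Ψ.symm x).2 := rfl

/-- `Ψ (re x, im x) = x`. [folklore] -/
theorem apply_re_im (x : S) : Ψ (re Ψ x, im Ψ x) = x := by
  rw [re_def, im_def, Prod.mk.eta, AddEquiv.apply_symm_apply]

/-- `re (Ψ (a, b)) = a`. [folklore] -/
@[simp] theorem re_apply (a b : R) : re Ψ (Ψ (a, b)) = a := by rw [re_def, AddEquiv.symm_apply_apply]

/-- `im (Ψ (a, b)) = b`. [folklore] -/
@[simp] theorem im_apply (a b : R) : im Ψ (Ψ (a, b)) = b := by rw [im_def, AddEquiv.symm_apply_apply]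

/-- The `2 × 2` matrix `(re x, d · im x; im x, re x)` of multiplication by `x` in the basis `(1, δ)`. [folklore] -/
def mulMatrixFun (d : R) (x : S) : Matrix (Fin 2) (Fin 2) R := !![re Ψ x, d * im Ψ x; im Ψ x, re Ψ x]

/-- Entry `(0,0)` of the multiplication matrix: `re x`. [folklore] -/
@[simp] theorem mulMatrixFun_apply_zero_zero (d : R) (x : S) : mulMatrixFun Ψ d x 0 0 = re Ψ x := rfl

/-- Entry `(0,1)` of the multiplication matrix: `d · im x`. [folklore] -/
@[simp] theorem mulMatrixFun_apply_zero_one (d : R) (x : S) : mulMatrixFun Ψ d x 0 1 = d * im Ψ x := rfl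

/-- Entry `(1,0)` of the multiplication matrix: `im x`. [folklore] -/
@[simp] theorem mulMatrixFun_apply_one_zero (d : R) (x : S) : mulMatrixFun Ψ d x 1 0 = im Ψ x := rfl

/-- Entry `(1,1)` of the multiplication matrix: `re x`. [folklore] -/
@[simp] theorem mulMatrixFun_apply_one_one (d : R) (x : S) : mulMatrixFun Ψ d x 1 1 = re Ψ x := rfl

/-- The coordinate vector of `x ∈ Sⁿ` in `R^{n × 2}`: `(j, 0) ↦ re x_j`, `(j, 1) ↦ im x_j`. [folklore] -/
def coords {n : Type*} (x : n → S) : n × Fin 2 → R := fun p => ![re Ψ (x p.1), im Ψ (x p.1)] p.2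

/-- Coordinate `(j, 0)` of `x` is `re (x j)`. [folklore] -/
@[simp] theorem coords_zero {n : Type*} (x : n → S) (j : n) : coords Ψ x (j, 0) = re Ψ (x j) := rfl

/-- Coordinate `(j, 1)` of `x` is `im (x j)`. [folklore] -/
@[simp] theorem coords_one {n : Type*} (x : n → S) (j : n) : coords Ψ x (j, 1) = im Ψ (x j) := rfl

variable [TopologicalSpace R] [TopologicalSpace S] in
/-- `re` is continuous when `Ψ⁻¹` is. [folklore] -/
theorem continuous_re (hΨ : Continuous Ψ.symm) : Continuous (re Ψ) := continuous_fst.comp hΨ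

variable [TopologicalSpace R] [TopologicalSpace S] in
/-- `im` is continuous when `Ψ⁻¹` is. [folklore] -/
theorem continuous_im (hΨ : Continuous Ψ.symm) : Continuous (im Ψ) := continuous_snd.comp hΨ

end QuadraticCoordinates

namespace IsQuadraticCoordinates

open QuadraticCoordinates

variable {φ : R →+* S} {Ψ : (R × R) ≃+ S} {δ : S} {d : R} (h : IsQuadraticCoordinates φ Ψ δ d)
include h

/-- `x = φ (re x) + φ (im x) · δ`. [folklore] -/
theorem re_add_im (x : S) : φ (re Ψ x) + φ (im Ψ x) * δ = x := by rw [← h.apply, apply_re_im]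

/-- `re (φ a + φ b · δ) = a`. [folklore] -/
theorem re_eq (a b : R) : re Ψ (φ a + φ b * δ) = a := by rw [← h.apply, re_apply]

/-- `im (φ a + φ b · δ) = b`. [folklore] -/
theorem im_eq (a b : R) : im Ψ (φ a + φ b * δ) = b := by rw [← h.apply, im_apply]

/-- `re (φ a) = a`. [folklore] -/
theorem re_map (a : R) : re Ψ (φ a) = a := by simpa using h.re_eq a 0

/-- `im (φ a) = 0`. [folklore] -/
theorem im_map (a : R) : im Ψ (φ a) = 0 := by simpa using h.im_eq a 0

/-- `re 1 = 1`. [folklore] -/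
theorem re_one : re Ψ 1 = 1 := by simpa using h.re_map 1

/-- `im 1 = 0`. [folklore] -/
theorem im_one : im Ψ 1 = 0 := by simpa using h.im_map 1

/-- `re δ = 0`. [folklore] -/
theorem re_delta : re Ψ δ = 0 := by simpa using h.re_eq 0 1

/-- `im δ = 1`. [folklore] -/
theorem im_delta : im Ψ δ = 1 := by simpa using h.im_eq 0 1

/-- **The multiplication rule** `(a + b δ)(a' + b' δ) = (a a' + d b b') + (a b' + b a') δ`. [folklore] -/
theorem mul_formula (a b a' b' : R) :
    (φ a + φ b * δ) * (φ a' + φ b' * δ) = φ (a * a' + d * (b * b')) + φ (a * b' + b * a') * δ := by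
  simp only [map_add, map_mul]
  linear_combination (φ b * φ b') * h.mul_self

/-- `re (x y) = re x · re y + d · im x · im y`. [folklore] -/
theorem re_mul (x y : S) : re Ψ (x * y) = re Ψ x * re Ψ y + d * (im Ψ x * im Ψ y) := by
  conv_lhs => rw [← h.re_add_im x, ← h.re_add_im y, h.mul_formula, h.re_eq]

/-- `im (x y) = re x · im y + im x · re y`. [folklore] -/
theorem im_mul (x y : S) : im Ψ (x * y) = re Ψ x * im Ψ y + im Ψ x * re Ψ y := by
  conv_lhs => rw [← h.re_add_im x, ← h.re_add_im y, h.mul_formula, h.im_eq]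

/-- **The regular representation** `S →+* M₂(R)`, `x ↦ (re x, d · im x; im x, re x)` = the matrix of
multiplication by `x` in the basis `(1, δ)`. [folklore] -/
def mulMatrix : S →+* Matrix (Fin 2) (Fin 2) R where
  toFun := mulMatrixFun Ψ d
  map_one' := by
    ext i j
    fin_cases i <;> fin_cases j <;> simp [h.re_one, h.im_one]
  map_mul' x y := by
    ext i j
    fin_cases i <;> fin_cases j <;> simp [Matrix.mul_apply, Fin.sum_univ_two, h.re_mul, h.im_mul] <;> ring
  map_zero' := by
    ext i j
    fin_cases i <;> fin_cases j <;> simp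
  map_add' x y := by
    ext i j
    fin_cases i <;> fin_cases j <;> simp [mul_add]

/-- `mulMatrix x` is the matrix `(re x, d · im x; im x, re x)` (definitional). [folklore] -/
@[simp] theorem mulMatrix_apply (x : S) : h.mulMatrix x = mulMatrixFun Ψ d x := rfl

/-- `x ↦ (re x, d · im x; im x, re x)` on `φ(R)`: the scalar matrix. [folklore] -/
theorem mulMatrix_map (a : R) : h.mulMatrix (φ a) = Matrix.scalar (Fin 2) a := by
  ext i j
  fin_cases i <;> fin_cases j <;> simp [h.re_map, h.im_map]

/-- The coordinates of a product: `(re (x y), im (x y)) = mulMatrix x · (re y, im y)`. [folklore] -/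
theorem mulMatrix_mulVec (x y : S) : h.mulMatrix x *ᵥ ![re Ψ y, im Ψ y] = ![re Ψ (x * y), im Ψ (x * y)] := by
  ext i
  fin_cases i <;> simp [Matrix.mulVec, dotProduct, Fin.sum_univ_two, h.re_mul, h.im_mul] <;> ring

/-- `mulMatrix` is injective. [folklore] -/
theorem mulMatrix_injective : Function.Injective h.mulMatrix := fun x y hxy => by
  have h0 : re Ψ x = re Ψ y := congrFun (congrFun hxy 0) 0
  have h1 : im Ψ x = im Ψ y := congrFun (congrFun hxy 1) 0
  rw [← h.re_add_im x, ← h.re_add_im y, h0, h1]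

variable (n : Type*) [Fintype n] [DecidableEq n]

/-- **Restriction of scalars for matrices**: `Res : Mₙ(S) →+* M_{n × 2}(R)`, the block matrix whose `(i, j)` block is
the `2 × 2` matrix of multiplication by `g i j` in the basis `(1, δ)` — i.e. the matrix of the `R`-linear map
`x ↦ g x` of `Sⁿ = R^{n × 2}` (`coords_mulVec`). [folklore] -/
def restrictScalars : Matrix n n S →+* Matrix (n × Fin 2) (n × Fin 2) R :=
  (Matrix.compRingEquiv n (Fin 2) R).toRingHom.comp h.mulMatrix.mapMatrix

/-- Entries of `Res g`. [folklore] -/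
@[simp] theorem restrictScalars_apply (g : Matrix n n S) (i : n) (k : Fin 2) (j : n) (l : Fin 2) :
    h.restrictScalars n g (i, k) (j, l) = mulMatrixFun Ψ d (g i j) k l := rfl

/-- **`Res` realises `g ↦ (x ↦ g x)` on coordinates**: `coords (g x) = Res g · coords x`. [folklore] -/
theorem coords_mulVec (g : Matrix n n S) (x : n → S) :
    coords Ψ (g *ᵥ x) = h.restrictScalars n g *ᵥ coords Ψ x := by
  ext ⟨i, k⟩
  change ![re Ψ ((g *ᵥ x) i), im Ψ ((g *ᵥ x) i)] k = _
  simp only [Matrix.mulVec, dotProduct, Fintype.sum_prod_type, restrictScalars_apply, Fin.sum_univ_two,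
    coords_zero, coords_one]
  fin_cases k
  · simp only [Fin.zero_eta, Matrix.cons_val_zero, map_sum, h.re_mul, mulMatrixFun_apply_zero_zero,
      mulMatrixFun_apply_zero_one]
    exact Finset.sum_congr rfl fun j _ => by ring
  · simp only [Fin.mk_one, Matrix.cons_val_one, Matrix.cons_val_fin_one, map_sum, h.im_mul,
      mulMatrixFun_apply_one_zero, mulMatrixFun_apply_one_one]
    exact Finset.sum_congr rfl fun j _ => by ring

/-- **`Res (a ⊗ 1) = a ⊗ 1₂`**: on matrices with entries in `φ(R)`, `Res` is the Kronecker product with `1₂`. [folklore] -/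
theorem restrictScalars_map (a : Matrix n n R) :
    h.restrictScalars n (a.map φ) = Matrix.kroneckerMap (· * ·) a (1 : Matrix (Fin 2) (Fin 2) R) := by
  ext ⟨i, k⟩ ⟨j, l⟩
  rw [restrictScalars_apply, Matrix.map_apply, ← h.mulMatrix_apply, h.mulMatrix_map, Matrix.kroneckerMap_apply,
    Matrix.scalar_apply, Matrix.diagonal_apply, Matrix.one_apply, mul_ite, mul_one, mul_zero]

/-- `Res` is injective. [folklore] -/
theorem restrictScalars_injective : Function.Injective (h.restrictScalars n) :=
  (Matrix.compRingEquiv n (Fin 2) R).injective.comp fun _ _ hgg' =>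
    Matrix.ext fun i j => h.mulMatrix_injective (congrFun (congrFun hgg' i) j)

/-- **Restriction of scalars on `GLₙ`**: `GLₙ(S) →* GL_{n × 2}(R)`. [folklore] -/
def restrictScalarsGL : GL n S →* GL (n × Fin 2) R := Units.map (h.restrictScalars n).toMonoidHom

/-- The underlying matrix of `Res g` for `g ∈ GLₙ(S)`. [folklore] -/
@[simp] theorem coe_restrictScalarsGL (g : GL n S) :
    ((h.restrictScalarsGL n g : GL (n × Fin 2) R) : Matrix (n × Fin 2) (n × Fin 2) R) = h.restrictScalars n g := rfl

/-- `GLₙ(S) →* GL_{n × 2}(R)` is injective. [folklore] -/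
theorem restrictScalarsGL_injective : Function.Injective (h.restrictScalarsGL n) := fun g g' hgg' => by
  apply Units.ext
  apply h.restrictScalars_injective n
  rw [← coe_restrictScalarsGL, ← coe_restrictScalarsGL, hgg']

variable [TopologicalSpace R] [TopologicalSpace S] [IsTopologicalRing R]

/-- `Res` is continuous when `Ψ⁻¹` is. [folklore] -/
theorem continuous_restrictScalars (hΨ : Continuous Ψ.symm) : Continuous (h.restrictScalars n) := by
  refine continuous_matrix fun ⟨i, k⟩ ⟨j, l⟩ => ?_
  simp only [restrictScalars_apply]
  have hre : Continuous fun g : Matrix n n S => re Ψ (g i j) :=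
    (continuous_re Ψ hΨ).comp ((continuous_apply j).comp (continuous_apply i))
  have him : Continuous fun g : Matrix n n S => im Ψ (g i j) :=
    (continuous_im Ψ hΨ).comp ((continuous_apply j).comp (continuous_apply i))
  fin_cases k <;> fin_cases l
  · exact hre
  · exact continuous_const.mul him
  · exact him
  · exact hre

/-- `GLₙ(S) →* GL_{n × 2}(R)` is continuous when `Ψ⁻¹` is. [folklore] -/
theorem continuous_restrictScalarsGL (hΨ : Continuous Ψ.symm) : Continuous (h.restrictScalarsGL n) :=
  Units.continuous_map (h.continuous_restrictScalars n hΨ)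

end IsQuadraticCoordinates

end QuadraticCoordinates

/-! ## 2. `δ² ∈ F` -/

section DeltaSquared

variable {F : Type} (E : Type) [Field F] [NumberField F] [Field E] [NumberField E] [Algebra F E]

/-- For a quadratic extension `E/F`, `σ ∈ Aut(E/F)` and `δ ≠ 0` with `σ δ = -δ`: **`δ² ∈ F`** (write
`δ² = x + y δ` in `E = F ⊕ F δ` and apply `σ`). [folklore] -/
theorem exists_mul_self_eq_algebraMap [Algebra.IsQuadraticExtension F E] (σ : E ≃ₐ[F] E) {δ : E}
    (hσδ : σ δ = -δ) (hδ : δ ≠ 0) : ∃ d : F, δ * δ = algebraMap F E d := by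
  obtain ⟨x, y, hxy⟩ :=
    exists_eq_add_mul_of_isQuadraticExtension E (not_mem_range_algebraMap_of_apply_eq_neg E σ hσδ hδ) (δ * δ)
  have hσ : σ (δ * δ) = δ * δ := by rw [map_mul, hσδ, neg_mul_neg]
  rw [hxy, map_add, map_mul, AlgEquiv.commutes, AlgEquiv.commutes, hσδ] at hσ
  have hy : (2 : E) * (algebraMap F E y * δ) = 0 := by linear_combination -hσ
  rcases mul_eq_zero.mp ((mul_eq_zero.mp hy).resolve_left two_ne_zero) with hy | hy
  · exact ⟨x, by rw [hxy, hy, zero_mul, add_zero]⟩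
  · exact absurd hy hδ

end DeltaSquared

/-! ## 3. The local carriers: `GLₙ(E ⊗_F F_v) → GL_{2n}(F_v)` at finite and infinite places -/

section LocalCarriers

variable {F : Type} (E : Type) [Field F] [NumberField F] [Field E] [NumberField E] [Algebra F E]

/-- **`E ⊗_F F_v = F_v ⊕ F_v δ` as quadratic coordinates** (`v` finite): `Ψ_v = quadraticLocalEquiv`,
`φ = ι_v = toLocalRing`. [folklore] -/
theorem isQuadraticCoordinates_local [Algebra.IsQuadraticExtension F E] (v : HeightOneSpectrum (𝓞 F))
    (σ : E ≃ₐ[F] E) {δ : E} (hσδ : σ δ = -δ) (hδ : δ ≠ 0) {d : F} (hd : δ * δ = algebraMap F E d) :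
    IsQuadraticCoordinates (toLocalRing E v) (quadraticLocalEquiv E v σ hσδ hδ).toLinearEquiv.toAddEquiv
      (algebraMap E (LocalRing E v) δ) (d : v.adicCompletion F) where
  apply a b := quadraticLocalEquiv_apply E v σ hσδ hδ (a, b)
  mul_self := by rw [← map_mul, hd, toLocalRing_coe]

/-- **`GLₙ(E ⊗_F F_v) →* GL_{n × 2}(F_v)`** (`v` finite): restriction of scalars in the basis `(1, δ)`. [folklore] -/
def localRestrictScalarsGL [Algebra.IsQuadraticExtension F E] (v : HeightOneSpectrum (𝓞 F)) (σ : E ≃ₐ[F] E)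
    {δ : E} (hσδ : σ δ = -δ) (hδ : δ ≠ 0) {d : F} (hd : δ * δ = algebraMap F E d) (n : Type*) [Fintype n]
    [DecidableEq n] : GL n (LocalRing E v) →* GL (n × Fin 2) (v.adicCompletion F) :=
  (isQuadraticCoordinates_local E v σ hσδ hδ hd).restrictScalarsGL n

/-- `GLₙ(E ⊗_F F_v) →* GL_{n × 2}(F_v)` is injective. [folklore] -/
theorem localRestrictScalarsGL_injective [Algebra.IsQuadraticExtension F E] (v : HeightOneSpectrum (𝓞 F))
    (σ : E ≃ₐ[F] E) {δ : E} (hσδ : σ δ = -δ) (hδ : δ ≠ 0) {d : F} (hd : δ * δ = algebraMap F E d) (n : Type*)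
    [Fintype n] [DecidableEq n] : Function.Injective (localRestrictScalarsGL E v σ hσδ hδ hd n) :=
  (isQuadraticCoordinates_local E v σ hσδ hδ hd).restrictScalarsGL_injective n

/-- `GLₙ(E ⊗_F F_v) →* GL_{n × 2}(F_v)` is continuous. [folklore] -/
theorem continuous_localRestrictScalarsGL [Algebra.IsQuadraticExtension F E] (v : HeightOneSpectrum (𝓞 F))
    (σ : E ≃ₐ[F] E) {δ : E} (hσδ : σ δ = -δ) (hδ : δ ≠ 0) {d : F} (hd : δ * δ = algebraMap F E d) (n : Type*)
    [Fintype n] [DecidableEq n] : Continuous (localRestrictScalarsGL E v σ hσδ hδ hd n) :=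
  (isQuadraticCoordinates_local E v σ hσδ hδ hd).continuous_restrictScalarsGL n
    (quadraticLocalEquiv E v σ hσδ hδ).symm.continuous

/-- On `GLₙ(F_v) ≤ GLₙ(E ⊗_F F_v)` (entries `ι_v a`), restriction of scalars is `a ↦ a ⊗ 1₂`. [folklore] -/
theorem localRestrictScalarsGL_map [Algebra.IsQuadraticExtension F E] (v : HeightOneSpectrum (𝓞 F))
    (σ : E ≃ₐ[F] E) {δ : E} (hσδ : σ δ = -δ) (hδ : δ ≠ 0) {d : F} (hd : δ * δ = algebraMap F E d) (n : Type*)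
    [Fintype n] [DecidableEq n] (a : GL n (v.adicCompletion F)) :
    ((localRestrictScalarsGL E v σ hσδ hδ hd n (Units.map (toLocalRing E v).mapMatrix.toMonoidHom a) :
        GL (n × Fin 2) (v.adicCompletion F)) : Matrix (n × Fin 2) (n × Fin 2) (v.adicCompletion F)) =
      Matrix.kroneckerMap (· * ·) (a : Matrix n n (v.adicCompletion F)) (1 : Matrix (Fin 2) (Fin 2) _) :=
  (isQuadraticCoordinates_local E v σ hσδ hδ hd).restrictScalars_map n a

open NumberField.InfinitePlace in
/-- **`E ⊗_F F_v = F_v ⊕ F_v δ` as quadratic coordinates** (`v` infinite): `Ψ_v = quadraticInfLocalEquiv`,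
`φ = ι_v = algebraMap F_v (∏_{w ∣ v} E_w)`. [folklore] -/
theorem isQuadraticCoordinates_infLocal [Algebra.IsQuadraticExtension F E] (v : InfinitePlace F) (σ : E ≃ₐ[F] E)
    {δ : E} (hσδ : σ δ = -δ) (hδ : δ ≠ 0) {d : F} (hd : δ * δ = algebraMap F E d) :
    IsQuadraticCoordinates (algebraMap v.Completion (InfLocalRing E v))
      (quadraticInfLocalEquiv E v (not_mem_range_algebraMap_of_apply_eq_neg E σ hσδ hδ)).toLinearEquiv.toAddEquiv
      (algebraMap E (InfLocalRing E v) δ) ((d : F) : v.Completion) where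
  apply a b := quadraticInfLocalEquiv_apply E v (not_mem_range_algebraMap_of_apply_eq_neg E σ hσδ hδ) (a, b)
  mul_self := by
    rw [← map_mul, hd]
    exact funext fun w => (toInfPlace_coe E v w d).symm

open NumberField.InfinitePlace in
/-- **`GLₙ(E ⊗_F F_v) →* GL_{n × 2}(F_v)`** (`v` infinite). [folklore] -/
def infLocalRestrictScalarsGL [Algebra.IsQuadraticExtension F E] (v : InfinitePlace F) (σ : E ≃ₐ[F] E) {δ : E}
    (hσδ : σ δ = -δ) (hδ : δ ≠ 0) {d : F} (hd : δ * δ = algebraMap F E d) (n : Type*) [Fintype n] [DecidableEq n] :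
    GL n (InfLocalRing E v) →* GL (n × Fin 2) v.Completion :=
  (isQuadraticCoordinates_infLocal E v σ hσδ hδ hd).restrictScalarsGL n

open NumberField.InfinitePlace in
/-- `GLₙ(E ⊗_F F_v) →* GL_{n × 2}(F_v)` (`v` infinite) is injective. [folklore] -/
theorem infLocalRestrictScalarsGL_injective [Algebra.IsQuadraticExtension F E] (v : InfinitePlace F)
    (σ : E ≃ₐ[F] E) {δ : E} (hσδ : σ δ = -δ) (hδ : δ ≠ 0) {d : F} (hd : δ * δ = algebraMap F E d) (n : Type*)
    [Fintype n] [DecidableEq n] : Function.Injective (infLocalRestrictScalarsGL E v σ hσδ hδ hd n) :=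
  (isQuadraticCoordinates_infLocal E v σ hσδ hδ hd).restrictScalarsGL_injective n

open NumberField.InfinitePlace in
/-- `GLₙ(E ⊗_F F_v) →* GL_{n × 2}(F_v)` (`v` infinite) is continuous. [folklore] -/
theorem continuous_infLocalRestrictScalarsGL [Algebra.IsQuadraticExtension F E] (v : InfinitePlace F)
    (σ : E ≃ₐ[F] E) {δ : E} (hσδ : σ δ = -δ) (hδ : δ ≠ 0) {d : F} (hd : δ * δ = algebraMap F E d) (n : Type*)
    [Fintype n] [DecidableEq n] : Continuous (infLocalRestrictScalarsGL E v σ hσδ hδ hd n) :=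
  (isQuadraticCoordinates_infLocal E v σ hσδ hδ hd).continuous_restrictScalarsGL n
    (quadraticInfLocalEquiv E v (not_mem_range_algebraMap_of_apply_eq_neg E σ hσδ hδ)).symm.continuous

open NumberField.InfinitePlace in
/-- On `GLₙ(F_v) ≤ GLₙ(E ⊗_F F_v)` (`v` infinite; entries `ι_v a`), restriction of scalars is `a ↦ a ⊗ 1₂`.
[folklore] -/
theorem infLocalRestrictScalarsGL_map [Algebra.IsQuadraticExtension F E] (v : InfinitePlace F) (σ : E ≃ₐ[F] E)
    {δ : E} (hσδ : σ δ = -δ) (hδ : δ ≠ 0) {d : F} (hd : δ * δ = algebraMap F E d) (n : Type*) [Fintype n]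
    [DecidableEq n] (a : GL n v.Completion) :
    ((infLocalRestrictScalarsGL E v σ hσδ hδ hd n
        (Units.map (algebraMap v.Completion (InfLocalRing E v)).mapMatrix.toMonoidHom a) :
          GL (n × Fin 2) v.Completion) : Matrix (n × Fin 2) (n × Fin 2) v.Completion) =
      Matrix.kroneckerMap (· * ·) (a : Matrix n n v.Completion) (1 : Matrix (Fin 2) (Fin 2) _) :=
  (isQuadraticCoordinates_infLocal E v σ hσδ hδ hd).restrictScalars_map n a

end LocalCarriers

/-! ## 4. The adelic carriers: `GLₙ(𝔸_E^∞) → GL_{2n}(𝔸_F^∞)` and `GLₙ(𝔸_E) → GL_{2n}(𝔸_F)` -/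

section AdelicCarriers

variable {F : Type} (E : Type) [Field F] [NumberField F] [Field E] [NumberField E] [Algebra F E]

/-- **`𝔸_E^∞ = 𝔸_F^∞ ⊕ 𝔸_F^∞ δ` as quadratic coordinates**: `Ψ = quadraticFiniteAdeleContinuousEquiv`,
`φ = (· ⊗ 1) = FiniteAdeleRing.baseChange`. [folklore] -/
theorem isQuadraticCoordinates_finiteAdele [Algebra.IsQuadraticExtension F E] (σ : E ≃ₐ[F] E) {δ : E}
    (hσδ : σ δ = -δ) (hδ : δ ≠ 0) {d : F} (hd : δ * δ = algebraMap F E d) :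
    IsQuadraticCoordinates (FiniteAdeleRing.baseChange (𝓞 F) F E (𝓞 E))
      (quadraticFiniteAdeleContinuousEquiv F E σ hσδ hδ).toAddEquiv (algebraMap E (FiniteAdeleRing (𝓞 E) E) δ)
      (algebraMap F (FiniteAdeleRing (𝓞 F) F) d) where
  apply a b := quadraticFiniteAdeleContinuousEquiv_apply E σ hσδ hδ (a, b)
  mul_self := by rw [← map_mul, hd, FiniteAdeleRing.baseChange_algebraMap]

/-- **`GLₙ(𝔸_E^∞) →* GL_{n × 2}(𝔸_F^∞)`**: restriction of scalars in the basis `(1, δ)`. [folklore] -/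
def finiteAdeleRestrictScalarsGL [Algebra.IsQuadraticExtension F E] (σ : E ≃ₐ[F] E) {δ : E} (hσδ : σ δ = -δ)
    (hδ : δ ≠ 0) {d : F} (hd : δ * δ = algebraMap F E d) (n : Type*) [Fintype n] [DecidableEq n] :
    GL n (FiniteAdeleRing (𝓞 E) E) →* GL (n × Fin 2) (FiniteAdeleRing (𝓞 F) F) :=
  (isQuadraticCoordinates_finiteAdele E σ hσδ hδ hd).restrictScalarsGL n

/-- `GLₙ(𝔸_E^∞) →* GL_{n × 2}(𝔸_F^∞)` is injective. [folklore] -/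
theorem finiteAdeleRestrictScalarsGL_injective [Algebra.IsQuadraticExtension F E] (σ : E ≃ₐ[F] E) {δ : E}
    (hσδ : σ δ = -δ) (hδ : δ ≠ 0) {d : F} (hd : δ * δ = algebraMap F E d) (n : Type*) [Fintype n] [DecidableEq n] :
    Function.Injective (finiteAdeleRestrictScalarsGL E σ hσδ hδ hd n) :=
  (isQuadraticCoordinates_finiteAdele E σ hσδ hδ hd).restrictScalarsGL_injective n

/-- `GLₙ(𝔸_E^∞) →* GL_{n × 2}(𝔸_F^∞)` is continuous. [folklore] -/
theorem continuous_finiteAdeleRestrictScalarsGL [Algebra.IsQuadraticExtension F E] (σ : E ≃ₐ[F] E) {δ : E}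
    (hσδ : σ δ = -δ) (hδ : δ ≠ 0) {d : F} (hd : δ * δ = algebraMap F E d) (n : Type*) [Fintype n] [DecidableEq n] :
    Continuous (finiteAdeleRestrictScalarsGL E σ hσδ hδ hd n) :=
  (isQuadraticCoordinates_finiteAdele E σ hσδ hδ hd).continuous_restrictScalarsGL n
    (quadraticFiniteAdeleContinuousEquiv F E σ hσδ hδ).symm.continuous

/-- On `GLₙ(𝔸_F^∞) ≤ GLₙ(𝔸_E^∞)` (entries `a ⊗ 1`), restriction of scalars is `a ↦ a ⊗ 1₂`. [folklore] -/
theorem finiteAdeleRestrictScalarsGL_map [Algebra.IsQuadraticExtension F E] (σ : E ≃ₐ[F] E) {δ : E}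
    (hσδ : σ δ = -δ) (hδ : δ ≠ 0) {d : F} (hd : δ * δ = algebraMap F E d) (n : Type*) [Fintype n] [DecidableEq n]
    (a : GL n (FiniteAdeleRing (𝓞 F) F)) :
    ((finiteAdeleRestrictScalarsGL E σ hσδ hδ hd n
        (Units.map (FiniteAdeleRing.baseChange (𝓞 F) F E (𝓞 E)).mapMatrix.toMonoidHom a) :
          GL (n × Fin 2) (FiniteAdeleRing (𝓞 F) F)) : Matrix (n × Fin 2) (n × Fin 2) (FiniteAdeleRing (𝓞 F) F)) =
      Matrix.kroneckerMap (· * ·) (a : Matrix n n (FiniteAdeleRing (𝓞 F) F)) (1 : Matrix (Fin 2) (Fin 2) _) :=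
  (isQuadraticCoordinates_finiteAdele E σ hσδ hδ hd).restrictScalars_map n a

/-- **`𝔸_E = 𝔸_F ⊕ 𝔸_F δ` as quadratic coordinates**: `Ψ = quadraticAdeleEquiv`, `φ = (· ⊗ 1) = AdeleRing.baseChange`.
[folklore] -/
theorem isQuadraticCoordinates_adele [Algebra.IsQuadraticExtension F E] (σ : E ≃ₐ[F] E) {δ : E}
    (hσδ : σ δ = -δ) (hδ : δ ≠ 0) {d : F} (hd : δ * δ = algebraMap F E d) :
    IsQuadraticCoordinates (AdeleRing.baseChange F E) (quadraticAdeleEquiv F E σ hσδ hδ).toAddEquiv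
      (algebraMap E (AdeleRing (𝓞 E) E) δ) (algebraMap F (AdeleRing (𝓞 F) F) d) where
  apply a b := quadraticAdeleEquiv_apply E σ hσδ hδ (a, b)
  mul_self := by rw [← map_mul, hd, AdeleRing.baseChange_algebraMap]

/-- **`GLₙ(𝔸_E) →* GL_{n × 2}(𝔸_F)`**: restriction of scalars in the basis `(1, δ)` — the carrier map
`GLₙ(E ⊗_F 𝔸_F) = GLₙ(𝔸_E) → GL_{2n}(𝔸_F)`. [folklore] -/
def adeleRestrictScalarsGL [Algebra.IsQuadraticExtension F E] (σ : E ≃ₐ[F] E) {δ : E} (hσδ : σ δ = -δ)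
    (hδ : δ ≠ 0) {d : F} (hd : δ * δ = algebraMap F E d) (n : Type*) [Fintype n] [DecidableEq n] :
    GL n (AdeleRing (𝓞 E) E) →* GL (n × Fin 2) (AdeleRing (𝓞 F) F) :=
  (isQuadraticCoordinates_adele E σ hσδ hδ hd).restrictScalarsGL n

/-- `GLₙ(𝔸_E) →* GL_{n × 2}(𝔸_F)` is injective. [folklore] -/
theorem adeleRestrictScalarsGL_injective [Algebra.IsQuadraticExtension F E] (σ : E ≃ₐ[F] E) {δ : E}
    (hσδ : σ δ = -δ) (hδ : δ ≠ 0) {d : F} (hd : δ * δ = algebraMap F E d) (n : Type*) [Fintype n] [DecidableEq n] :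
    Function.Injective (adeleRestrictScalarsGL E σ hσδ hδ hd n) :=
  (isQuadraticCoordinates_adele E σ hσδ hδ hd).restrictScalarsGL_injective n

/-- `GLₙ(𝔸_E) →* GL_{n × 2}(𝔸_F)` is continuous. [folklore] -/
theorem continuous_adeleRestrictScalarsGL [Algebra.IsQuadraticExtension F E] (σ : E ≃ₐ[F] E) {δ : E}
    (hσδ : σ δ = -δ) (hδ : δ ≠ 0) {d : F} (hd : δ * δ = algebraMap F E d) (n : Type*) [Fintype n] [DecidableEq n] :
    Continuous (adeleRestrictScalarsGL E σ hσδ hδ hd n) :=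
  (isQuadraticCoordinates_adele E σ hσδ hδ hd).continuous_restrictScalarsGL n
    (quadraticAdeleEquiv F E σ hσδ hδ).symm.continuous

/-- On `GLₙ(𝔸_F) ≤ GLₙ(𝔸_E)` (entries `a ⊗ 1`), restriction of scalars is `a ↦ a ⊗ 1₂`. [folklore] -/
theorem adeleRestrictScalarsGL_map [Algebra.IsQuadraticExtension F E] (σ : E ≃ₐ[F] E) {δ : E}
    (hσδ : σ δ = -δ) (hδ : δ ≠ 0) {d : F} (hd : δ * δ = algebraMap F E d) (n : Type*) [Fintype n] [DecidableEq n]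
    (a : GL n (AdeleRing (𝓞 F) F)) :
    ((adeleRestrictScalarsGL E σ hσδ hδ hd n (Units.map (AdeleRing.baseChange F E).mapMatrix.toMonoidHom a) :
          GL (n × Fin 2) (AdeleRing (𝓞 F) F)) : Matrix (n × Fin 2) (n × Fin 2) (AdeleRing (𝓞 F) F)) =
      Matrix.kroneckerMap (· * ·) (a : Matrix n n (AdeleRing (𝓞 F) F)) (1 : Matrix (Fin 2) (Fin 2) _) :=
  (isQuadraticCoordinates_adele E σ hσδ hδ hd).restrictScalars_map n a

/-- Parameter-free existence: for a quadratic extension `E/F` of number fields there are `δ ∈ E ∖ F` with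
`δ² = d ∈ F` and the restriction-of-scalars maps above (a `σ` with `σ δ = -δ` exists). [folklore] -/
theorem exists_quadraticCoordinates_adele [Algebra.IsQuadraticExtension F E] :
    ∃ (δ : E) (d : F) (Ψ : (AdeleRing (𝓞 F) F × AdeleRing (𝓞 F) F) ≃ₜ+ AdeleRing (𝓞 E) E),
      IsQuadraticCoordinates (AdeleRing.baseChange F E) Ψ.toAddEquiv (algebraMap E (AdeleRing (𝓞 E) E) δ)
        (algebraMap F (AdeleRing (𝓞 F) F) d) := by
  obtain ⟨σ, δ, hσδ, hδ⟩ := exists_algEquiv_apply_eq_neg (F := F) (E := E)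
  obtain ⟨d, hd⟩ := exists_mul_self_eq_algebraMap E σ hσδ hδ
  exact ⟨δ, d, quadraticAdeleEquiv F E σ hσδ hδ, isQuadraticCoordinates_adele E σ hσδ hδ hd⟩

end AdelicCarriers

/-! ## 5. The unitary-group carriers: `U(J)(F_v) → GL_{N × 2}(F_v)`, `U(J)(𝔸_F) → GL_{N × 2}(𝔸_F)` -/

section UnitaryCarriers

variable {F : Type} (E : Type) [Field F] [NumberField F] [Field E] [NumberField E] [Algebra F E]
variable (c : E ≃ₐ[F] E) (N : ℕ) (J : Matrix (Fin N) (Fin N) E)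

/-- **`U(J)(F_v) ≤ GL_N(E ⊗_F F_v) → GL_{N × 2}(F_v)`** (`v` finite): the unitary group of the hermitian space
`(Eᴺ, J)` acts `F_v`-linearly on `Res (E ⊗_F F_v)ᴺ = F_v^{N × 2}` (for `N = 3`: `U(V)(F_v) → GL₆(F_v)`). [folklore] -/
def localUnitaryCarrier [Algebra.IsQuadraticExtension F E] (v : HeightOneSpectrum (𝓞 F)) (σ : E ≃ₐ[F] E) {δ : E}
    (hσδ : σ δ = -δ) (hδ : δ ≠ 0) {d : F} (hd : δ * δ = algebraMap F E d) :
    «local» E c N J v →* GL (Fin N × Fin 2) (v.adicCompletion F) :=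
  (localRestrictScalarsGL E v σ hσδ hδ hd (Fin N)).comp («local» E c N J v).subtype

/-- Underlying matrix of `localUnitaryCarrier g` = restriction of scalars of `g`. [folklore] -/
@[simp] theorem localUnitaryCarrier_apply [Algebra.IsQuadraticExtension F E] (v : HeightOneSpectrum (𝓞 F))
    (σ : E ≃ₐ[F] E) {δ : E} (hσδ : σ δ = -δ) (hδ : δ ≠ 0) {d : F} (hd : δ * δ = algebraMap F E d)
    (g : «local» E c N J v) :
    localUnitaryCarrier E c N J v σ hσδ hδ hd g = localRestrictScalarsGL E v σ hσδ hδ hd (Fin N) g.1 := rfl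

/-- `U(J)(F_v) → GL_{N × 2}(F_v)` is injective. [folklore] -/
theorem localUnitaryCarrier_injective [Algebra.IsQuadraticExtension F E] (v : HeightOneSpectrum (𝓞 F))
    (σ : E ≃ₐ[F] E) {δ : E} (hσδ : σ δ = -δ) (hδ : δ ≠ 0) {d : F} (hd : δ * δ = algebraMap F E d) :
    Function.Injective (localUnitaryCarrier E c N J v σ hσδ hδ hd) :=
  (localRestrictScalarsGL_injective E v σ hσδ hδ hd (Fin N)).comp Subtype.val_injective

/-- `U(J)(F_v) → GL_{N × 2}(F_v)` is continuous. [folklore] -/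
theorem continuous_localUnitaryCarrier [Algebra.IsQuadraticExtension F E] (v : HeightOneSpectrum (𝓞 F))
    (σ : E ≃ₐ[F] E) {δ : E} (hσδ : σ δ = -δ) (hδ : δ ≠ 0) {d : F} (hd : δ * δ = algebraMap F E d) :
    Continuous (localUnitaryCarrier E c N J v σ hσδ hδ hd) :=
  (continuous_localRestrictScalarsGL E v σ hσδ hδ hd (Fin N)).comp continuous_subtype_val

/-- **`U(J)(F_v) ≤ Π_{w ∣ v} GL_N(E_w) → GL_{N × 2}(F_v)`** (the factor form `localPi` of `U(J)(F_v)`, regrouped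
along `GL_N(Π_w E_w) = Π_w GL_N(E_w)`). [folklore] -/
def localPiUnitaryCarrier [Algebra.IsQuadraticExtension F E] (v : HeightOneSpectrum (𝓞 F)) (σ : E ≃ₐ[F] E)
    {δ : E} (hσδ : σ δ = -δ) (hδ : δ ≠ 0) {d : F} (hd : δ * δ = algebraMap F E d) :
    localPi E c N J v →* GL (Fin N × Fin 2) (v.adicCompletion F) :=
  (localUnitaryCarrier E c N J v σ hσδ hδ hd).comp (localPiEquiv E c N J v).toMonoidHom

/-- `localPi → GL_{N × 2}(F_v)` is injective. [folklore] -/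
theorem localPiUnitaryCarrier_injective [Algebra.IsQuadraticExtension F E] (v : HeightOneSpectrum (𝓞 F))
    (σ : E ≃ₐ[F] E) {δ : E} (hσδ : σ δ = -δ) (hδ : δ ≠ 0) {d : F} (hd : δ * δ = algebraMap F E d) :
    Function.Injective (localPiUnitaryCarrier E c N J v σ hσδ hδ hd) :=
  (localUnitaryCarrier_injective E c N J v σ hσδ hδ hd).comp (localPiEquiv E c N J v).injective

/-- `localPi → GL_{N × 2}(F_v)` is continuous. [folklore] -/
theorem continuous_localPiUnitaryCarrier [Algebra.IsQuadraticExtension F E] (v : HeightOneSpectrum (𝓞 F))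
    (σ : E ≃ₐ[F] E) {δ : E} (hσδ : σ δ = -δ) (hδ : δ ≠ 0) {d : F} (hd : δ * δ = algebraMap F E d) :
    Continuous (localPiUnitaryCarrier E c N J v σ hσδ hδ hd) :=
  (continuous_localUnitaryCarrier E c N J v σ hσδ hδ hd).comp (localPiEquiv E c N J v).continuous

variable (F) in
/-- **`U(J)(𝔸_F) ≤ GL_N(𝔸_E) → GL_{N × 2}(𝔸_F)`**: the adelic unitary group acts `𝔸_F`-linearly on
`Res 𝔸_Eᴺ = 𝔸_F^{N × 2}` (for `N = 3`: `U(V)(𝔸_F) → GL₆(𝔸_F)`). [folklore] -/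
def adelicUnitaryCarrier [Algebra.IsQuadraticExtension F E] (σ : E ≃ₐ[F] E) {δ : E} (hσδ : σ δ = -δ)
    (hδ : δ ≠ 0) {d : F} (hd : δ * δ = algebraMap F E d) :
    adelic F E c N J →* GL (Fin N × Fin 2) (AdeleRing (𝓞 F) F) :=
  (adeleRestrictScalarsGL E σ hσδ hδ hd (Fin N)).comp (adelic F E c N J).subtype

/-- Underlying matrix of `adelicUnitaryCarrier g` = restriction of scalars of `g`. [folklore] -/
@[simp] theorem adelicUnitaryCarrier_apply [Algebra.IsQuadraticExtension F E] (σ : E ≃ₐ[F] E) {δ : E}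
    (hσδ : σ δ = -δ) (hδ : δ ≠ 0) {d : F} (hd : δ * δ = algebraMap F E d) (g : adelic F E c N J) :
    adelicUnitaryCarrier F E c N J σ hσδ hδ hd g = adeleRestrictScalarsGL E σ hσδ hδ hd (Fin N) g.1 := rfl

/-- `U(J)(𝔸_F) → GL_{N × 2}(𝔸_F)` is injective. [folklore] -/
theorem adelicUnitaryCarrier_injective [Algebra.IsQuadraticExtension F E] (σ : E ≃ₐ[F] E) {δ : E}
    (hσδ : σ δ = -δ) (hδ : δ ≠ 0) {d : F} (hd : δ * δ = algebraMap F E d) :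
    Function.Injective (adelicUnitaryCarrier F E c N J σ hσδ hδ hd) :=
  (adeleRestrictScalarsGL_injective E σ hσδ hδ hd (Fin N)).comp Subtype.val_injective

/-- `U(J)(𝔸_F) → GL_{N × 2}(𝔸_F)` is continuous. [folklore] -/
theorem continuous_adelicUnitaryCarrier [Algebra.IsQuadraticExtension F E] (σ : E ≃ₐ[F] E) {δ : E}
    (hσδ : σ δ = -δ) (hδ : δ ≠ 0) {d : F} (hd : δ * δ = algebraMap F E d) :
    Continuous (adelicUnitaryCarrier F E c N J σ hσδ hδ hd) :=
  (continuous_adeleRestrictScalarsGL E σ hσδ hδ hd (Fin N)).comp continuous_subtype_val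

end UnitaryCarriers

end UnitaryGroup

end Literature.NumberTheory.Automorphic

end
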